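import Mathlib.NumberTheory.Padics.PadicVal.Basic
import Mathlib.Data.Int.LeastGreatest
import Literature.NumberTheory.Automorphic.BrandtModule
import Literature.NumberTheory.Automorphic.BrandtIndexReducedNorm
import Literature.NumberTheory.Automorphic.QuaternionOrderIntegral
import Literature.NumberTheory.Automorphic.LatticeLocalGlobal
import Literature.NumberTheory.Automorphic.QuaternionInvolutionToolkit
import HarnessLib

/-!
# Invertible ideals of quaternion orders are locally principal (Kaplansky)

Topic `NumberTheory/Automorphic`; two small definitions (`transporterRight`, `transporterLeft`, the
lattices `{y | M y ⊆ N}` and `{x | x M ⊆ N}`), otherwise theorems; no named fact, no instance.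
For a `ℤ`-order `O` (`IsZOrder`, `BrandtModule.lean`) in a division quaternion algebra `B` over
`ℚ` and an invertible right `O`-ideal `I` (`IsInvertibleRightIdeal O I`: full lattice, right
order `O`, two-sided inverse), we prove **Kaplansky's theorem** in the form needed by the
arithmetic of Brandt modules (Eichler's mass formula, multiplicativity and traces of Brandt
matrices): for every prime `p`,

  `I_(p) = α O_(p)` for some `α ∈ I`      (`IsInvertibleRightIdeal.exists_localAt_eq_units_smul`),

where `L_(p) = localAt p L` is the localisation inside `B` of `LatticeLocalGlobal.lean`. Source:
J. Voight, *Quaternion Algebras*, Main Theorem 16.6.1 ("an `R`-lattice `I` is invertible if and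
only if `I` is locally principal", proof due to Kaplansky, *Submodules of quaternion algebras*,
Proc. LMS 19 (1969), Thm. 2), with the reduction 16.6.9 and the notions of §16.6 (semi-orders,
Def. 16.6.4; Lemma 16.6.5; 16.6.6; Cor. 16.6.8). We follow the printed proof step by step over
`R = ℤ_(p)`:

1. `Localise`: left/right orders and products commute with localisation
   (`leftOrderOf_localAt`, `rightOrderOf_localAt`; Voight 9.4).
2. `Norms`: `v_p(nrd x)` is bounded below on a lattice, so some `α ∈ I` minimises it
   (`exists_mem_padicValRat_reducedNorm_le`, Voight 16.6.9).
3. `SemiOrder`: `J = (α⁻¹ I)_(p)` contains `1` and has `p`-integral norms; hence `p`-integral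
   traces (Lemma 16.6.5), `J̄ = J` (16.6.6), Kaplansky's congruence `x y + y x ∈ J` ((16.6.11)),
   `x² ∈ J`, and `O_ℓ(J) ⊆ O_r(J)` (Cor. 16.6.8).
4. `Core`: with a `ℤ_(p)`-basis `1, f₂, f₃, f₄` of `J`, every product of four basis elements lies
   in `J³` (a factor `1`, or a repeated factor pushed together by the congruence), so `J⁴ = J³`
   ((16.6.10) with `n = 4`).
5. `Kaplansky`: multiplying by the inverse of `J` peels off factors, `J³ = J²`, `J² = J`,
   `J = O_ℓ(J)`; therefore `J = O_r(J) = O_(p)` and `I_(p) = α O_(p)`.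

6. `Transporter`, `LocalCriterion`: conversely (Voight 16.6.14 / Main Thm. 16.6.1 "⇐"), a full
   lattice that is locally principal at every prime is an invertible right `O`-ideal, the inverse
   being the right transporter `{y | M y ⊆ O_ℓ(M)}` (`transporterRight`, with its left analogue
   `transporterLeft`; both localise); whence `isInvertibleRightIdeal_iff_forall_localAt_eq`.

`p`-integrality of a rational is expressed as `¬ p ∣ q.den`; valuations are Mathlib's
`padicValRat`. The division-algebra hypothesis (`∀ x ≠ 0, IsUnit x`, automatic for totally
definite `B`, `isUnit_of_isTotallyDefinite`) is used only to make non-zero elements have non-zero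
reduced norm.

## References

* J. Voight, *Quaternion Algebras*, GTM 288 (2021), §9.4, §16.6 (Main Thm. 16.6.1, 16.6.4–16.6.9)
  [Voight2021].
* I. Kaplansky, *Submodules of quaternion algebras*, Proc. London Math. Soc. (3) 19 (1969),
  219–232, Thm. 2.
* M.-F. Vignéras, *Arithmétique des algèbres de quaternions*, LNM 800 (1980), Ch. I §4 (ordres,
  idéaux), Ch. II §1–2 (idéaux localement principaux) [VignerasLNM800].
-/

noncomputable section

open scoped Pointwise

universe u

namespace Literature.NumberTheory.Automorphic

/-! ### Orders and one-sided ideals localise -/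

section Localise

variable {B : Type u} [Ring B]

/-- `O_ℓ(I)_(p) ⊆ O_ℓ(I_(p))`. [folklore] -/
theorem localAt_leftOrderOf_le (p : ℕ) (I : Submodule ℤ B) :
    localAt p (leftOrderOf I) ≤ leftOrderOf (localAt p I) := by
  rintro x ⟨m, hm0, hm, hmx⟩ y ⟨n, hn0, hn, hny⟩
  refine ⟨m * n, mul_ne_zero hm0 hn0, hm.mul_left hn, ?_⟩
  rw [Nat.cast_mul, mul_smul, smul_comm, ← smul_mul_assoc, ← mul_smul_comm]
  exact hmx _ hny

/-- `O_r(I)_(p) ⊆ O_r(I_(p))`. [folklore] -/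
theorem localAt_rightOrderOf_le (p : ℕ) (I : Submodule ℤ B) :
    localAt p (rightOrderOf I) ≤ rightOrderOf (localAt p I) := by
  rintro x ⟨m, hm0, hm, hmx⟩ y ⟨n, hn0, hn, hny⟩
  refine ⟨n * m, mul_ne_zero hn0 hm0, hn.mul_left hm, ?_⟩
  rw [Nat.cast_mul, mul_smul, ← mul_smul_comm, ← smul_mul_assoc]
  exact hmx _ hny

/-- **Left orders localise**: `O_ℓ(I_(p)) = O_ℓ(I)_(p)` for a finitely generated lattice `I`
(Voight 9.4 / 10.2: `O_L(I)_(p) = O_L(I_(p))`). [folklore] -/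
theorem leftOrderOf_localAt (p : ℕ) {I : Submodule ℤ B} (hI : I.FG) :
    leftOrderOf (localAt p I) = localAt p (leftOrderOf I) := by
  classical
  refine le_antisymm (fun x hx => ?_) (localAt_leftOrderOf_le p I)
  obtain ⟨t, rfl⟩ := hI
  -- a common multiplier `m` with `m x g ∈ span t` for the generators `g ∈ t`
  have key : ∀ g ∈ t, ∃ m : ℕ, m ≠ 0 ∧ m.Coprime p ∧ (m : ℤ) • (x * g) ∈ Submodule.span ℤ (t : Set B) :=
    fun g hg => hx g (le_localAt p _ (Submodule.subset_span hg))
  choose! m hm0 hm hmx using key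
  refine ⟨∏ g ∈ t, m g, Finset.prod_ne_zero_iff.mpr fun g hg => hm0 g hg,
    Nat.Coprime.prod_left fun g hg => hm g hg, fun y hy => ?_⟩
  rw [smul_mul_assoc]
  refine Submodule.span_induction (p := fun y _ => ((∏ g ∈ t, m g : ℕ) : ℤ) • (x * y) ∈
      Submodule.span ℤ (t : Set B)) (fun g hg => ?_) (by simp) (fun a b _ _ ha hb => ?_)
    (fun c a _ ha => ?_) hy
  · rw [← Finset.prod_erase_mul _ _ hg, Nat.cast_mul, mul_smul]
    exact Submodule.smul_mem _ _ (hmx g hg)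
  · rw [mul_add, smul_add]
    exact add_mem ha hb
  · rw [mul_smul_comm, smul_comm]
    exact Submodule.smul_mem _ _ ha

/-- **Right orders localise**: `O_r(I_(p)) = O_r(I)_(p)` for a finitely generated lattice `I`. [folklore] -/
theorem rightOrderOf_localAt (p : ℕ) {I : Submodule ℤ B} (hI : I.FG) :
    rightOrderOf (localAt p I) = localAt p (rightOrderOf I) := by
  classical
  refine le_antisymm (fun x hx => ?_) (localAt_rightOrderOf_le p I)
  obtain ⟨t, rfl⟩ := hI
  have key : ∀ g ∈ t, ∃ m : ℕ, m ≠ 0 ∧ m.Coprime p ∧ (m : ℤ) • (g * x) ∈ Submodule.span ℤ (t : Set B) :=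
    fun g hg => hx g (le_localAt p _ (Submodule.subset_span hg))
  choose! m hm0 hm hmx using key
  refine ⟨∏ g ∈ t, m g, Finset.prod_ne_zero_iff.mpr fun g hg => hm0 g hg,
    Nat.Coprime.prod_left fun g hg => hm g hg, fun y hy => ?_⟩
  rw [mul_smul_comm]
  refine Submodule.span_induction (p := fun y _ => ((∏ g ∈ t, m g : ℕ) : ℤ) • (y * x) ∈
      Submodule.span ℤ (t : Set B)) (fun g hg => ?_) (by simp) (fun a b _ _ ha hb => ?_)
    (fun c a _ ha => ?_) hy
  · rw [← Finset.prod_erase_mul _ _ hg, Nat.cast_mul, mul_smul]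
    exact Submodule.smul_mem _ _ (hmx g hg)
  · rw [add_mul, smul_add]
    exact add_mem ha hb
  · rw [smul_mul_assoc, smul_comm]
    exact Submodule.smul_mem _ _ ha

/-- The localisation of a multiplicatively closed lattice is multiplicatively closed. [folklore] -/
theorem mul_mem_localAt {O : Submodule ℤ B} (hmul : ∀ a ∈ O, ∀ b ∈ O, a * b ∈ O) (p : ℕ)
    {a b : B} (ha : a ∈ localAt p O) (hb : b ∈ localAt p O) : a * b ∈ localAt p O := by
  obtain ⟨m, hm0, hm, hma⟩ := ha
  obtain ⟨n, hn0, hn, hnb⟩ := hb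
  refine ⟨m * n, mul_ne_zero hm0 hn0, hm.mul_left hn, ?_⟩
  rw [Nat.cast_mul, mul_smul, smul_comm, ← smul_mul_assoc, ← mul_smul_comm]
  exact hmul _ hma _ hnb

/-- `O_(p) · O_(p) = O_(p)` for a `ℤ`-order `O`. [folklore] -/
theorem IsZOrder.localAt_mul_localAt {O : Submodule ℤ B} (hO : IsZOrder O) (p : ℕ) :
    localAt p O * localAt p O = localAt p O := by
  refine le_antisymm (Submodule.mul_le.mpr fun a ha b hb => mul_mem_localAt hO.mul_mem p ha hb)
    fun a ha => ?_
  rw [← mul_one a]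
  exact Submodule.mul_mem_mul ha (le_localAt p O hO.one_mem)

end Localise

/-! ### `p`-integral scalars act on localised lattices -/

section PIntegral

variable {V : Type u} [AddCommGroup V] [Module ℚ V]

/-- A rational number whose denominator is prime to `p` acts on `ℤ_(p)`-modules:
`q • x ∈ L_(p)` for `x ∈ L_(p)`. [folklore] -/
theorem rat_smul_mem_localAt {p : ℕ} [hp : Fact p.Prime] {L : Submodule ℤ V} {x : V}
    (hx : x ∈ localAt p L) {q : ℚ} (hq : ¬ p ∣ q.den) : q • x ∈ localAt p L := by
  have hden : q.den.Coprime p := Nat.coprime_comm.mp ((Nat.Prime.coprime_iff_not_dvd hp.out).mpr hq)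
  have hq' : q = (q.num : ℚ) * ((q.den : ℚ))⁻¹ := by
    rw [← div_eq_mul_inv, Rat.num_div_den]
  rw [hq', mul_smul, Int.cast_smul_eq_zsmul]
  exact (localAt p L).smul_mem _ (inv_smul_mem_localAt q.den_nz hden hx)

/-- Integers have denominator `1`, prime to `p`. [folklore] -/
theorem not_dvd_den_intCast {p : ℕ} (hp : p.Prime) (z : ℤ) : ¬ p ∣ (z : ℚ).den := by
  rw [Rat.den_intCast]
  exact hp.one_lt.ne' ∘ Nat.dvd_one.mp

/-- `p`-integral rationals are closed under addition. [folklore] -/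
theorem not_dvd_den_add {p : ℕ} (hp : p.Prime) {q r : ℚ} (hq : ¬ p ∣ q.den) (hr : ¬ p ∣ r.den) :
    ¬ p ∣ (q + r).den := fun h =>
  (Nat.Prime.dvd_mul hp).mp (h.trans (Rat.add_den_dvd q r)) |>.elim hq hr

/-- `p`-integral rationals are closed under negation. [folklore] -/
theorem not_dvd_den_neg {p : ℕ} {q : ℚ} (hq : ¬ p ∣ q.den) : ¬ p ∣ (-q).den := by
  rwa [Rat.neg_den]

/-- `p`-integral rationals are closed under subtraction. [folklore] -/
theorem not_dvd_den_sub {p : ℕ} (hp : p.Prime) {q r : ℚ} (hq : ¬ p ∣ q.den) (hr : ¬ p ∣ r.den) :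
    ¬ p ∣ (q - r).den := by
  rw [sub_eq_add_neg]
  exact not_dvd_den_add hp hq (not_dvd_den_neg hr)

/-- `p`-integral rationals are closed under multiplication. [folklore] -/
theorem not_dvd_den_mul {p : ℕ} (hp : p.Prime) {q r : ℚ} (hq : ¬ p ∣ q.den) (hr : ¬ p ∣ r.den) :
    ¬ p ∣ (q * r).den := fun h =>
  (Nat.Prime.dvd_mul hp).mp (h.trans (Rat.mul_den_dvd q r)) |>.elim hq hr

/-- A rational of non-negative `p`-adic valuation has denominator prime to `p`. [folklore] -/
theorem not_dvd_den_of_padicValRat_nonneg {p : ℕ} [hp : Fact p.Prime] {q : ℚ}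
    (hq : 0 ≤ padicValRat p q) : ¬ p ∣ q.den := by
  intro hd
  have hnum : ¬ (p : ℤ) ∣ q.num := fun hn => by
    have h1 : p ∣ q.num.natAbs := Int.natCast_dvd.mp hn
    have := Nat.dvd_gcd h1 hd
    rw [q.reduced] at this
    exact hp.out.one_lt.ne' (Nat.dvd_one.mp this)
  have h1 : padicValInt p q.num = 0 := padicValInt.eq_zero_of_not_dvd hnum
  have h2 : 1 ≤ padicValNat p q.den := one_le_padicValNat_of_dvd q.den_nz hd
  rw [padicValRat_def, h1, Nat.cast_zero, zero_sub] at hq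
  have h2' : (1 : ℤ) ≤ padicValNat p q.den := by exact_mod_cast h2
  omega

end PIntegral

/-! ### Reduced norms on lattices: `p`-adic valuations are bounded below -/

section Norms

variable {B : Type u} [Ring B] [Algebra ℚ B] [IsQuaternionAlgebra ℚ B]

omit [Algebra ℚ B] [IsQuaternionAlgebra ℚ B] in
/-- A `ℤ`-order in the sense of `BrandtModule.lean` is one in the sense of `BrandtXi.lean`
(same three fields). [folklore] -/
theorem IsZOrder.toIsOrder {O : Submodule ℤ B} (hO : IsZOrder O) : Brandt.IsOrder B O :=
  ⟨hO.one_mem, hO.mul_mem, hO.isFullLattice⟩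

/-- Elements of a `ℤ`-order have integral reduced norm. [cite: VignerasLNM800, Ch. I §4 Lemme 4.1] -/
theorem IsZOrder.exists_int_reducedNorm {O : Submodule ℤ B} (hO : IsZOrder O) {x : B}
    (hx : x ∈ O) : ∃ n : ℤ, reducedNorm ℚ B x = n := by
  obtain ⟨-, n, -, hn⟩ := hO.toIsOrder.exists_int_reducedTrace_reducedNorm hx
  exact ⟨n, hn⟩

/-- The reduced norm of a non-zero element of a division quaternion algebra is non-zero. [folklore] -/
theorem reducedNorm_ne_zero_of_ne_zero (hdiv : ∀ x : B, x ≠ 0 → IsUnit x) {x : B} (hx : x ≠ 0) :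
    reducedNorm ℚ B x ≠ 0 :=
  (isUnit_iff_reducedNorm_ne_zero_holds ℚ B x).mp (hdiv x hx)

/-- `nrd(u⁻¹) = nrd(u)⁻¹` for a unit `u`. [folklore] -/
theorem reducedNorm_units_inv (u : Bˣ) :
    reducedNorm ℚ B ((u⁻¹ : Bˣ) : B) = (reducedNorm ℚ B (u : B))⁻¹ := by
  have h := reducedNorm_mul_holds ℚ B ((u⁻¹ : Bˣ) : B) (u : B)
  rw [Units.inv_mul, reducedNorm_one ℚ B] at h
  have hu : reducedNorm ℚ B (u : B) ≠ 0 := (isUnit_iff_reducedNorm_ne_zero_holds ℚ B (u : B)).mp u.isUnit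
  field_simp
  linear_combination -h

variable {p : ℕ} [hp : Fact p.Prime]

/-- An integer prime to `p` has `p`-adic valuation `0` (as a rational). [folklore] -/
theorem padicValRat_natCast_eq_zero_of_coprime {m : ℕ} (hm : m.Coprime p) : padicValRat p (m : ℚ) = 0 := by
  rw [padicValRat.of_nat, Nat.cast_eq_zero]
  exact padicValNat.eq_zero_of_not_dvd fun h => hp.out.one_lt.ne' (Nat.Coprime.eq_one_of_dvd hm.symm h)

/-- **The `p`-adic valuations of the reduced norms of the non-zero elements of a finitely
generated lattice are bounded below** (`n I ⊆ O` for some `n ≠ 0` and `nrd(n x) = n² nrd(x) ∈ ℤ`).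
[folklore] -/
theorem exists_le_padicValRat_reducedNorm {O : Submodule ℤ B} (hO : IsZOrder O) {I : Submodule ℤ B}
    (hI : I.FG) : ∃ c : ℤ, ∀ x ∈ I, c ≤ padicValRat p (reducedNorm ℚ B x) := by
  obtain ⟨n, hn, hnI⟩ := exists_smul_mem_of_fg hO.isFullLattice hI
  refine ⟨-(2 * padicValRat p (n : ℚ)), fun x hx => ?_⟩
  have hvn : 0 ≤ padicValRat p (n : ℚ) := by
    rw [padicValRat.of_int]; exact_mod_cast Nat.zero_le _
  by_cases h0 : reducedNorm ℚ B x = 0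
  · rw [h0, padicValRat.zero]; linarith
  obtain ⟨m, hm⟩ := hO.exists_int_reducedNorm (hnI x hx)
  rw [reducedNorm_zsmul] at hm
  have hnQ : (n : ℚ) ≠ 0 := by exact_mod_cast hn
  have hx : reducedNorm ℚ B x = (m : ℚ) / (n : ℚ) ^ 2 := by
    rw [eq_div_iff (pow_ne_zero 2 hnQ), mul_comm, hm]
  have hm0 : (m : ℚ) ≠ 0 := by
    rw [← hm]; exact mul_ne_zero (pow_ne_zero 2 hnQ) h0
  have hvm : 0 ≤ padicValRat p (m : ℚ) := by
    rw [padicValRat.of_int]; exact_mod_cast Nat.zero_le _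
  rw [hx, padicValRat.div hm0 (pow_ne_zero 2 hnQ), padicValRat.pow]
  push_cast
  linarith

/-- **An element of minimal norm valuation**: a full lattice `I` in a quaternion algebra over
`ℚ` contains `α ≠ 0` with `v_p(nrd α) ≤ v_p(nrd x)` for all `x ∈ I` of non-zero norm
(Voight 16.6.9: "let `α ∈ I` achieve this minimum"). [cite: Voight2021, 16.6.9] -/
theorem exists_mem_padicValRat_reducedNorm_le {O : Submodule ℤ B} (hO : IsZOrder O)
    {I : Submodule ℤ B} (hI : IsFullLattice B I) :
    ∃ α ∈ I, α ≠ 0 ∧ ∀ x ∈ I, reducedNorm ℚ B x ≠ 0 →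
      padicValRat p (reducedNorm ℚ B α) ≤ padicValRat p (reducedNorm ℚ B x) := by
  classical
  haveI : Nontrivial B := Module.nontrivial_of_finrank_pos (R := ℚ)
    (by rw [IsQuaternionAlgebra.finrank_eq_four (K := ℚ) (D := B)]; norm_num)
  haveI : IsAddTorsionFree B := isAddTorsionFree_of_charZero_module ℚ B
  -- the set of valuations of non-zero norms of elements of `I`
  let P : ℤ → Prop := fun v => ∃ x ∈ I, reducedNorm ℚ B x ≠ 0 ∧ padicValRat p (reducedNorm ℚ B x) = v
  obtain ⟨c, hc⟩ := exists_le_padicValRat_reducedNorm (p := p) hO hI.1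
  obtain ⟨n, hn, hn1⟩ := hI.2 1
  have hn1' : reducedNorm ℚ B (n • (1 : B)) ≠ 0 := by
    rw [reducedNorm_zsmul, reducedNorm_one ℚ B, mul_one]
    exact pow_ne_zero 2 (by exact_mod_cast hn)
  obtain ⟨v, ⟨α, hαI, hα0, rfl⟩, hmin⟩ := Int.exists_least_of_bdd (P := P)
    ⟨c, fun v ⟨x, hx, _, hv⟩ => hv ▸ hc x hx⟩ ⟨_, n • 1, hn1, hn1', rfl⟩
  refine ⟨α, hαI, fun h => hα0 (by rw [h]; exact reducedNorm_apply_zero ℚ), fun x hx hx0 => ?_⟩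
  exact hmin _ ⟨x, hx, hx0, rfl⟩

end Norms

/-! ### `p`-semi-orders: `ℤ_(p)`-lattices containing `1` with `p`-integral norms (Voight 16.6.4) -/

section SemiOrder

variable {B : Type u} [Ring B] [Algebra ℚ B] [IsQuaternionAlgebra ℚ B]
variable {p : ℕ} [hp : Fact p.Prime] {J : Submodule ℤ B}

omit [IsQuaternionAlgebra ℚ B] in
/-- In a `ℤ_(p)`-module, `q · x ∈ J` for `x ∈ J` and every `p`-integral rational `q`. [folklore] -/
theorem rat_smul_mem_of_localAt_eq (hJp : localAt p J = J) {x : B} (hx : x ∈ J) {q : ℚ}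
    (hq : ¬ p ∣ q.den) : q • x ∈ J := by
  rw [← hJp] at hx ⊢
  exact rat_smul_mem_localAt hx hq

omit [IsQuaternionAlgebra ℚ B] in
/-- `algebraMap ℚ B q ∈ J` for `p`-integral `q`, when `1 ∈ J = J_(p)`. [folklore] -/
theorem algebraMap_mem_of_localAt_eq (hJp : localAt p J = J) (h1 : (1 : B) ∈ J) {q : ℚ}
    (hq : ¬ p ∣ q.den) : algebraMap ℚ B q ∈ J := by
  rw [Algebra.algebraMap_eq_smul_one]
  exact rat_smul_mem_of_localAt_eq hJp h1 hq

/-- **Semi-orders have `p`-integral traces** (Voight Lemma 16.6.5: `nrd(y+1) = nrd y + trd y + 1`).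
[cite: Voight2021, Lemma 16.6.5] -/
theorem not_dvd_den_reducedTrace_of_semiOrder (h1 : (1 : B) ∈ J)
    (hint : ∀ y ∈ J, ¬ p ∣ (reducedNorm ℚ B y).den) {y : B} (hy : y ∈ J) :
    ¬ p ∣ (reducedTrace ℚ B y).den := by
  have key : reducedTrace ℚ B y = reducedNorm ℚ B (y + 1) - reducedNorm ℚ B y - 1 := by
    rw [reducedNorm_add ℚ y 1, standardInvolution_one, mul_one, reducedNorm_one ℚ B]
    ring
  rw [key]
  refine not_dvd_den_sub hp.out (not_dvd_den_sub hp.out (hint _ (J.add_mem hy h1)) (hint _ hy)) ?_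
  exact_mod_cast not_dvd_den_intCast hp.out 1

/-- **Semi-orders are stable under the standard involution**: `ȳ = trd(y) - y ∈ J`
(Voight 16.6.6, Exercise 16.14). [cite: Voight2021, 16.6.6] -/
theorem standardInvolution_mem_of_semiOrder (hJp : localAt p J = J) (h1 : (1 : B) ∈ J)
    (hint : ∀ y ∈ J, ¬ p ∣ (reducedNorm ℚ B y).den) {y : B} (hy : y ∈ J) :
    standardInvolution ℚ B y ∈ J := by
  rw [standardInvolution_def]
  exact J.sub_mem (algebraMap_mem_of_localAt_eq hJp h1
    (not_dvd_den_reducedTrace_of_semiOrder h1 hint hy)) hy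

/-- The polar form is `p`-integral on a semi-order: `trd(x ȳ) = nrd(x+y) - nrd x - nrd y`. [folklore] -/
theorem not_dvd_den_reducedTrace_mul_standardInvolution_of_semiOrder
    (hint : ∀ y ∈ J, ¬ p ∣ (reducedNorm ℚ B y).den) {x y : B} (hx : x ∈ J) (hy : y ∈ J) :
    ¬ p ∣ (reducedTrace ℚ B (x * standardInvolution ℚ B y)).den := by
  have key : reducedTrace ℚ B (x * standardInvolution ℚ B y) =
      reducedNorm ℚ B (x + y) - reducedNorm ℚ B x - reducedNorm ℚ B y := by
    rw [reducedNorm_add ℚ x y]; ring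
  rw [key]
  exact not_dvd_den_sub hp.out (not_dvd_den_sub hp.out (hint _ (J.add_mem hx hy)) (hint _ hx))
    (hint _ hy)

/-- **Kaplansky's congruence `x y ≡ -y x (mod J)`**: `x y + y x ∈ J` for `x, y` in a semi-order
(Voight, proof of Main Thm. 16.6.1, from (16.6.11)). [cite: Voight2021, Main Thm. 16.6.1 (proof)] -/
theorem mul_add_mul_comm_mem_of_semiOrder (hJp : localAt p J = J) (h1 : (1 : B) ∈ J)
    (hint : ∀ y ∈ J, ¬ p ∣ (reducedNorm ℚ B y).den) {x y : B} (hx : x ∈ J) (hy : y ∈ J) :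
    x * y + y * x ∈ J := by
  rw [mul_add_mul_comm_eq ℚ x y, ← Algebra.smul_def, ← Algebra.smul_def]
  refine J.sub_mem (J.add_mem ?_ ?_) ?_
  · exact rat_smul_mem_of_localAt_eq hJp hx (not_dvd_den_reducedTrace_of_semiOrder h1 hint hy)
  · exact rat_smul_mem_of_localAt_eq hJp hy (not_dvd_den_reducedTrace_of_semiOrder h1 hint hx)
  · exact algebraMap_mem_of_localAt_eq hJp h1
      (not_dvd_den_reducedTrace_mul_standardInvolution_of_semiOrder hint hx hy)

/-- `x² = trd(x) x - nrd(x) ∈ J` for `x` in a semi-order. [cite: Voight2021, Main Thm. 16.6.1 (proof)] -/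
theorem mul_self_mem_of_semiOrder (hJp : localAt p J = J) (h1 : (1 : B) ∈ J)
    (hint : ∀ y ∈ J, ¬ p ∣ (reducedNorm ℚ B y).den) {x : B} (hx : x ∈ J) : x * x ∈ J := by
  rw [mul_self_eq_smul_sub ℚ x]
  exact J.sub_mem (rat_smul_mem_of_localAt_eq hJp hx (not_dvd_den_reducedTrace_of_semiOrder h1 hint hx))
    (algebraMap_mem_of_localAt_eq hJp h1 (hint x hx))

/-- **The left order of a semi-order is contained in its right order** (Voight Cor. 16.6.8:
`O_L(I) = O_R(I)` for a semi-order; here the inclusion, for `J = L_(p)` with `L` finitely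
generated, via `J̄ = J` and `(x̄ ȳ)‾ = y x`). [cite: Voight2021, Cor. 16.6.8] -/
theorem leftOrderOf_le_rightOrderOf_of_semiOrder {L : Submodule ℤ B} (hL : L.FG)
    (hJL : localAt p L = J) (h1 : (1 : B) ∈ J)
    (hint : ∀ y ∈ J, ¬ p ∣ (reducedNorm ℚ B y).den) : leftOrderOf J ≤ rightOrderOf J := by
  have hJp : localAt p J = J := by rw [← hJL, localAt_localAt]
  intro x hx y hy
  -- `x ∈ O_ℓ(J) ⊆ J`, so `trd x` is `p`-integral and `x̄ ∈ O_ℓ(J)` (`O_ℓ(J)` is a `ℤ_(p)`-module ∋ 1)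
  have hxJ : x ∈ J := by simpa using hx 1 h1
  have hOp : localAt p (leftOrderOf J) = leftOrderOf J := by
    rw [← hJL, leftOrderOf_localAt p hL, localAt_localAt]
  have hxbar : standardInvolution ℚ B x ∈ leftOrderOf J := by
    rw [standardInvolution_def]
    refine (leftOrderOf J).sub_mem ?_ hx
    rw [Algebra.algebraMap_eq_smul_one]
    exact rat_smul_mem_of_localAt_eq hOp (one_mem_leftOrderOf J)
      (not_dvd_den_reducedTrace_of_semiOrder h1 hint hxJ)
  -- `y x = (x̄ ȳ)‾ ∈ J̄ = J`
  have h := standardInvolution_mem_of_semiOrder hJp h1 hint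
    (hxbar _ (standardInvolution_mem_of_semiOrder hJp h1 hint hy))
  rwa [standardInvolution_mul_rev, standardInvolution_standardInvolution,
    standardInvolution_standardInvolution] at h

end SemiOrder

/-! ### The combinatorial core: `J⁴ ⊆ J³` for a semi-order spanned over `ℤ_(p)` by `1` and three elements -/

section Core

variable {B : Type u} [Ring B] [Algebra ℚ B] [IsQuaternionAlgebra ℚ B]
variable {p : ℕ} [hp : Fact p.Prime] {J : Submodule ℤ B}

omit [Algebra ℚ B] [IsQuaternionAlgebra ℚ B] hp in
/-- `a b c ∈ J³` for `a, b, c ∈ J`. [folklore] -/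
theorem mul_mul_mem_pow_three {a b c : B} (ha : a ∈ J) (hb : b ∈ J) (hc : c ∈ J) :
    a * b * c ∈ J ^ 3 := by
  rw [pow_succ, pow_two]
  exact Submodule.mul_mem_mul (Submodule.mul_mem_mul ha hb) hc

omit [Algebra ℚ B] [IsQuaternionAlgebra ℚ B] hp in
/-- If `s + t ∈ M` and `t ∈ M` then `s ∈ M`. [folklore] -/
theorem mem_of_add_mem_of_mem {M : Submodule ℤ B} {s t : B} (hst : s + t ∈ M) (ht : t ∈ M) :
    s ∈ M := by
  simpa using M.sub_mem hst ht

variable (hJp : localAt p J = J) (h1 : (1 : B) ∈ J) (hint : ∀ y ∈ J, ¬ p ∣ (reducedNorm ℚ B y).den)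
include hJp h1 hint

/-- Adjacent transposition in positions `(1,2)`: `(x y) c d + (y x) c d ∈ J³`. [folklore] -/
theorem swap12_mem {x y c d : B} (hx : x ∈ J) (hy : y ∈ J) (hc : c ∈ J) (hd : d ∈ J) :
    x * y * c * d + y * x * c * d ∈ J ^ 3 := by
  have h := mul_mul_mem_pow_three (mul_add_mul_comm_mem_of_semiOrder hJp h1 hint hx hy) hc hd
  simpa only [add_mul] using h

/-- Adjacent transposition in positions `(2,3)`: `a (x y) d + a (y x) d ∈ J³`. [folklore] -/
theorem swap23_mem {a x y d : B} (ha : a ∈ J) (hx : x ∈ J) (hy : y ∈ J) (hd : d ∈ J) :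
    a * x * y * d + a * y * x * d ∈ J ^ 3 := by
  have h := mul_mul_mem_pow_three ha (mul_add_mul_comm_mem_of_semiOrder hJp h1 hint hx hy) hd
  simpa only [mul_add, add_mul, mul_assoc] using h

/-- Adjacent transposition in positions `(3,4)`: `a b (x y) + a b (y x) ∈ J³`. [folklore] -/
theorem swap34_mem {a b x y : B} (ha : a ∈ J) (hb : b ∈ J) (hx : x ∈ J) (hy : y ∈ J) :
    a * b * x * y + a * b * y * x ∈ J ^ 3 := by
  have h := mul_mul_mem_pow_three ha hb (mul_add_mul_comm_mem_of_semiOrder hJp h1 hint hx hy)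
  simpa only [mul_add, mul_assoc] using h

/-- A product `a b c d` of elements of a semi-order with a repeated factor lies in `J³`
(Voight, proof of Main Thm. 16.6.1: push the repetition together with `x y ≡ -y x`, then use
`x² ∈ J`). [cite: Voight2021, Main Thm. 16.6.1 (proof)] -/
theorem prod_mem_pow_three_of_repeat {a b c d : B} (ha : a ∈ J) (hb : b ∈ J) (hc : c ∈ J)
    (hd : d ∈ J) (hrep : a = b ∨ a = c ∨ a = d ∨ b = c ∨ b = d ∨ c = d) :
    a * b * c * d ∈ J ^ 3 := by
  have sq := fun {x : B} (hx : x ∈ J) => mul_self_mem_of_semiOrder hJp h1 hint hx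
  -- the three "adjacent square" shapes
  have P12 : ∀ {x c d : B}, x ∈ J → c ∈ J → d ∈ J → x * x * c * d ∈ J ^ 3 :=
    fun hx hc hd => mul_mul_mem_pow_three (sq hx) hc hd
  have P23 : ∀ {a x d : B}, a ∈ J → x ∈ J → d ∈ J → a * x * x * d ∈ J ^ 3 := fun ha hx hd => by
    have h := mul_mul_mem_pow_three ha (sq hx) hd
    simpa only [mul_assoc] using h
  have P34 : ∀ {a b x : B}, a ∈ J → b ∈ J → x ∈ J → a * b * x * x ∈ J ^ 3 := fun ha hb hx => by
    have h := mul_mul_mem_pow_three ha hb (sq hx)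
    simpa only [mul_assoc] using h
  -- positions `(1,3)`: `x b x d ≡ -x x b d`
  have P13 : ∀ {x b d : B}, x ∈ J → b ∈ J → d ∈ J → x * b * x * d ∈ J ^ 3 := fun hx hb hd =>
    mem_of_add_mem_of_mem (swap23_mem hJp h1 hint hx hb hx hd) (P12 hx hb hd)
  rcases hrep with rfl | rfl | rfl | rfl | rfl | rfl
  · exact P12 ha hc hd
  · exact P13 ha hb hd
  · -- `(1,4)`: `a b c a ≡ -a b a c`, and `a b a c ∈ J³` by `(1,3)`
    exact mem_of_add_mem_of_mem (swap34_mem hJp h1 hint ha hb hc ha) (P13 ha hb hc)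
  · exact P23 ha hb hd
  · -- `(2,4)`: `a b c b ≡ -a b b c`
    exact mem_of_add_mem_of_mem (swap34_mem hJp h1 hint ha hb hc hb) (P23 ha hb hc)
  · exact P34 ha hb hc

/-- **`J⁴ ⊆ J³` on generators** (Voight, proof of Main Thm. 16.6.1 with `n = 4`): if
`S' ⊆ J` has at most three elements, every product of four elements of `{1} ∪ S'` lies in `J³`
(a factor `1` leaves a triple product; otherwise two factors coincide by pigeonhole).
[cite: Voight2021, Main Thm. 16.6.1 (proof)] -/
theorem prod_mem_pow_three_of_mem_insert [DecidableEq B] {S' : Finset B} (hS' : ∀ s ∈ S', s ∈ J)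
    (hcard : S'.card ≤ 3) {a b c d : B} (ha : a ∈ insert (1 : B) S') (hb : b ∈ insert (1 : B) S')
    (hc : c ∈ insert (1 : B) S') (hd : d ∈ insert (1 : B) S') : a * b * c * d ∈ J ^ 3 := by
  have hJ : ∀ {s : B}, s ∈ insert (1 : B) S' → s ∈ J := fun hs => by
    rcases Finset.mem_insert.mp hs with rfl | hs
    exacts [h1, hS' _ hs]
  rcases Finset.mem_insert.mp ha with rfl | ha'
  · simpa using mul_mul_mem_pow_three (hJ hb) (hJ hc) (hJ hd)
  rcases Finset.mem_insert.mp hb with rfl | hb'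
  · simpa using mul_mul_mem_pow_three (hJ ha) (hJ hc) (hJ hd)
  rcases Finset.mem_insert.mp hc with rfl | hc'
  · simpa using mul_mul_mem_pow_three (hJ ha) (hJ hb) (hJ hd)
  rcases Finset.mem_insert.mp hd with rfl | hd'
  · simpa using mul_mul_mem_pow_three (hJ ha) (hJ hb) (hJ hc)
  refine prod_mem_pow_three_of_repeat hJp h1 hint (hJ ha) (hJ hb) (hJ hc) (hJ hd) ?_
  by_contra hne
  simp only [not_or] at hne
  obtain ⟨hab, hac, had, hbc, hbd, hcd⟩ := hne
  have hsub : ({a, b, c, d} : Finset B) ⊆ S' := by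
    intro s hs
    simp only [Finset.mem_insert, Finset.mem_singleton] at hs
    rcases hs with rfl | rfl | rfl | rfl <;> assumption
  have hcard4 : ({a, b, c, d} : Finset B).card = 4 := by
    rw [Finset.card_insert_of_notMem, Finset.card_insert_of_notMem, Finset.card_insert_of_notMem,
      Finset.card_singleton] <;> simp [*]
  have := Finset.card_le_card hsub
  omega

end Core

/-! ### Kaplansky's theorem -/

section Kaplansky

variable {B : Type u} [Ring B] [Algebra ℚ B] [IsQuaternionAlgebra ℚ B]

omit [Algebra ℚ B] [IsQuaternionAlgebra ℚ B] in
/-- `x ∈ u • I ↔ u⁻¹ x ∈ I`, in product form. [folklore] -/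
theorem mem_units_smul_iff_mul_mem {u : Bˣ} {I : Submodule ℤ B} {x : B} :
    x ∈ u • I ↔ ((u⁻¹ : Bˣ) : B) * x ∈ I := by
  rw [mem_units_smul_submodule_iff, Units.smul_def, smul_eq_mul]

/-- **Kaplansky's theorem** (Voight, *Quaternion Algebras*, Main Thm. 16.6.1 with 16.6.9, for
`R = ℤ` localised at a prime `p`; Kaplansky 1969, Thm. 2): an invertible right ideal `I` of a
`ℤ`-order `O` in a division quaternion algebra over `ℚ` is **locally principal** — for every prime
`p` there is `α ∈ I`, `α ≠ 0`, with `I_(p) = α O_(p)`.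

Proof (following Voight): choose `α ∈ I` of minimal `v_p(nrd)`; then `J = (α⁻¹ I)_(p)` is a
`p`-semi-order (`1 ∈ J`, `nrd(J)` `p`-integral); `1` extends to a `ℤ_(p)`-basis `1, f₂, f₃, f₄` of
`J`, and the relation `x y ≡ -y x (mod J)` with `fᵢ² ∈ J` gives `J⁴ = J³`
(`prod_mem_pow_three_of_mem_insert`); multiplying by the inverse of `J` (which exists since `I`
is invertible, and `O_ℓ(J) ⊆ O_r(J)`) peels off one factor at a time: `J³ = J²`, `J² = J`,
`J = O_ℓ(J)`, whence `J = O_r(J) = O_(p)` and `I_(p) = α O_(p)`. [cite: Voight2021, Main Thm. 16.6.1] -/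
theorem IsInvertibleRightIdeal.exists_localAt_eq_units_smul (hdiv : ∀ x : B, x ≠ 0 → IsUnit x)
    {O I : Submodule ℤ B} (hO : IsZOrder O) (hI : IsInvertibleRightIdeal O I) (p : ℕ)
    [hp : Fact p.Prime] :
    ∃ α : Bˣ, (α : B) ∈ I ∧ localAt p I = α • localAt p O := by
  classical
  haveI : IsAddTorsionFree B := isAddTorsionFree_of_charZero_module ℚ B
  haveI : Nontrivial B := Module.nontrivial_of_finrank_pos (R := ℚ)
    (by rw [IsQuaternionAlgebra.finrank_eq_four (K := ℚ) (D := B)]; norm_num)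
  -- Step 1: `α ∈ I` of minimal norm valuation
  obtain ⟨α₀, hα₀I, hα₀0, hmin⟩ := exists_mem_padicValRat_reducedNorm_le (p := p) hO hI.isFullLattice
  let α : Bˣ := (hdiv α₀ hα₀0).unit
  have hαval : (α : B) = α₀ := rfl
  have hnα : reducedNorm ℚ B (α : B) ≠ 0 := reducedNorm_ne_zero_of_ne_zero hdiv hα₀0
  refine ⟨α, hα₀I, ?_⟩
  -- Step 2: `L = α⁻¹ I`, an invertible right `O`-ideal containing `1`; `J = L_(p)` is a semi-order
  set L : Submodule ℤ B := α⁻¹ • I with hLdef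
  have hL : IsInvertibleRightIdeal O L := hI.units_smul α⁻¹
  have h1L : (1 : B) ∈ L := by
    rw [hLdef, mem_units_smul_iff_mul_mem, inv_inv, mul_one]; exact hα₀I
  set J : Submodule ℤ B := localAt p L with hJdef
  have hJp : localAt p J = J := localAt_localAt p L
  have h1 : (1 : B) ∈ J := le_localAt p L h1L
  have hint : ∀ y ∈ J, ¬ p ∣ (reducedNorm ℚ B y).den := by
    rintro y ⟨m, hm0, hm, hmy⟩
    rw [hLdef, mem_units_smul_iff_mul_mem, inv_inv] at hmy
    -- `x := α (m y) ∈ I`, `nrd y = nrd x / (m² nrd α)`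
    set x := (α : B) * ((m : ℤ) • y) with hx
    by_cases hy0 : y = 0
    · rw [hy0, reducedNorm_apply_zero ℚ]; exact not_dvd_den_intCast hp.out 0
    have hmQ : (m : ℚ) ≠ 0 := by exact_mod_cast hm0
    have hx0 : x ≠ 0 := fun h => hy0 <| by
      have h' : (m : ℤ) • y = 0 := by
        have := congrArg (fun z => ((α⁻¹ : Bˣ) : B) * z) h
        simpa only [hx, Units.inv_mul_cancel_left, mul_zero] using this
      rw [natCast_zsmul_eq_ratCast_smul] at h'
      exact (smul_eq_zero.mp h').resolve_left hmQ
    have hnx : reducedNorm ℚ B x ≠ 0 := reducedNorm_ne_zero_of_ne_zero hdiv hx0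
    have hnrd : reducedNorm ℚ B y = reducedNorm ℚ B x / ((m : ℚ) ^ 2 * reducedNorm ℚ B α) := by
      rw [hx, reducedNorm_mul_holds ℚ B, natCast_zsmul_eq_ratCast_smul, reducedNorm_smul]
      field_simp
    refine not_dvd_den_of_padicValRat_nonneg ?_
    rw [hnrd, padicValRat.div hnx (mul_ne_zero (pow_ne_zero 2 hmQ) hnα),
      padicValRat.mul (pow_ne_zero 2 hmQ) hnα, padicValRat.pow,
      padicValRat_natCast_eq_zero_of_coprime hm]
    have := hmin x hmy hnx
    rw [hαval] 
    linarith
  -- Step 3: a `ℤ_(p)`-basis of `J` containing `1`: `J = (span {1} ∪ S')_(p)` with `|S'| ≤ 3`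
  obtain ⟨S', hS'J, hcard, hA⟩ : ∃ S' : Finset B, (∀ s ∈ S', s ∈ J) ∧ S'.card ≤ 3 ∧
      localAt p (Submodule.span ℤ (↑(insert (1 : B) S') : Set B)) = J := by
    haveI : Module.Finite ℤ L := Module.Finite.iff_fg.mpr hL.isFullLattice.1
    haveI : IsAddTorsionFree L := L.toAddSubgroup.instIsAddTorsionFree
    haveI := isLocalizedModule_subtype_of_isFullLattice hL.isFullLattice
    let b := Module.Free.chooseBasis ℤ L
    let bQ : Module.Basis _ ℚ B := b.ofIsLocalizedModule ℚ (nonZeroDivisors ℤ) L.subtype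
    have hcard4 : Fintype.card (Module.Free.ChooseBasisIndex ℤ L) = 4 := by
      rw [← Module.finrank_eq_card_basis bQ, IsQuaternionAlgebra.finrank_eq_four (K := ℚ) (D := B)]
    have hbL : ∀ i, (b i : B) ∈ L := fun i => (b i).2
    -- expand `m • 1 ∈ L` in the basis
    obtain ⟨m, hm0, hm, hm1⟩ := h1
    let a : Module.Free.ChooseBasisIndex ℤ L → ℤ := fun i => b.repr ⟨(m : ℤ) • 1, hm1⟩ i
    have hsum : ∑ i, a i • (b i : B) = (m : ℤ) • (1 : B) := by
      have h := congrArg Subtype.val (b.sum_repr ⟨(m : ℤ) • 1, hm1⟩)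
      simpa only [AddSubmonoidClass.coe_finsetSum, Submodule.coe_smul_of_tower] using h
    -- some coefficient is prime to `p` (else `p⁻¹ ∈ J`, of norm `p⁻²`)
    obtain ⟨i₀, hi₀⟩ : ∃ i₀, ¬ (p : ℤ) ∣ a i₀ := by
      by_contra hall
      simp only [not_exists, not_not] at hall
      choose c hc using hall
      have hw' : (m : ℤ) • (1 : B) = (p : ℤ) • ∑ i, c i • (b i : B) := by
        rw [← hsum, Finset.smul_sum]
        exact Finset.sum_congr rfl fun i _ => by rw [hc i, mul_smul]
      have hmem : ∑ i, c i • (b i : B) ∈ L := L.sum_mem fun i _ => L.smul_mem _ (hbL i)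
      have hy : (p : ℚ)⁻¹ • (1 : B) ∈ J := by
        refine ⟨m, hm0, hm, ?_⟩
        have : (m : ℤ) • ((p : ℚ)⁻¹ • (1 : B)) = ∑ i, c i • (b i : B) := by
          rw [smul_comm, hw', natCast_zsmul_eq_ratCast_smul p,
            inv_smul_smul₀ (by exact_mod_cast hp.out.ne_zero)]
        rw [this]
        exact hmem
      have h := hint _ hy
      rw [reducedNorm_smul, reducedNorm_one ℚ B, mul_one, inv_pow, ← Nat.cast_pow,
        Rat.inv_natCast_den, if_neg (pow_ne_zero 2 hp.out.ne_zero)] at h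
      exact h (dvd_pow_self p two_ne_zero)
    have hcop : (a i₀).natAbs.Coprime p :=
      ((Nat.Prime.coprime_iff_not_dvd hp.out).mpr fun h => hi₀ (Int.natCast_dvd.mpr h)).symm
    have hna0 : (a i₀).natAbs ≠ 0 := Int.natAbs_ne_zero.mpr fun h0 => hi₀ (h0 ▸ dvd_zero _)
    refine ⟨(Finset.univ.erase i₀).image fun i => (b i : B), ?_, ?_, ?_⟩
    · intro s hs
      obtain ⟨i, -, rfl⟩ := Finset.mem_image.mp hs
      exact le_localAt p L (hbL i)
    · calc ((Finset.univ.erase i₀).image fun i => (b i : B)).card ≤ (Finset.univ.erase i₀).card :=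
            Finset.card_image_le
        _ = 3 := by rw [Finset.card_erase_of_mem (Finset.mem_univ _), Finset.card_univ, hcard4]
    · set A : Submodule ℤ B :=
        Submodule.span ℤ (↑(insert (1 : B) ((Finset.univ.erase i₀).image fun i => (b i : B))) : Set B)
        with hAdef
      have h1A : (1 : B) ∈ A := Submodule.subset_span (Finset.mem_coe.mpr (Finset.mem_insert_self _ _))
      have hbA : ∀ i, i ≠ i₀ → (b i : B) ∈ A := fun i hi =>
        Submodule.subset_span (Finset.mem_coe.mpr (Finset.mem_insert_of_mem
          (Finset.mem_image_of_mem _ (Finset.mem_erase.mpr ⟨hi, Finset.mem_univ i⟩))))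
      have hAJ : A ≤ J := by
        refine Submodule.span_le.mpr fun s hs => ?_
        rcases Finset.mem_insert.mp (Finset.mem_coe.mp hs) with rfl | hs
        · exact ⟨m, hm0, hm, hm1⟩
        · obtain ⟨i, -, rfl⟩ := Finset.mem_image.mp hs
          exact le_localAt p L (hbL i)
      -- `b i₀ ∈ A_(p)`: `a i₀ • b i₀ = m • 1 - ∑_{i ≠ i₀} a i • b i ∈ A` with `a i₀` prime to `p`
      have hsplit : a i₀ • (b i₀ : B) = (m : ℤ) • 1 - ∑ i ∈ Finset.univ.erase i₀, a i • (b i : B) := by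
        rw [← hsum, ← Finset.add_sum_erase _ _ (Finset.mem_univ i₀)]
        abel
      have hmemA : a i₀ • (b i₀ : B) ∈ A := by
        rw [hsplit]
        exact A.sub_mem (A.smul_mem _ h1A)
          (A.sum_mem fun i hi => A.smul_mem _ (hbA i (Finset.ne_of_mem_erase hi)))
      have hbi₀ : (b i₀ : B) ∈ localAt p A := by
        refine ⟨(a i₀).natAbs, hna0, hcop, ?_⟩
        rcases Int.natAbs_eq (a i₀) with h | h
        · rw [← h]; exact hmemA
        · rw [Int.natCast_natAbs, abs_of_neg ?_, neg_smul]
          · exact A.neg_mem hmemA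
          · omega
      have hball : ∀ i, (b i : B) ∈ localAt p A := fun i => by
        by_cases hi : i = i₀
        · rw [hi]; exact hbi₀
        · exact le_localAt p A (hbA i hi)
      refine le_antisymm ((localAt_mono p hAJ).trans hJp.le) ?_
      rw [hJdef]
      refine localAt_le_localAt_iff.mpr fun x hx => ?_
      have hx' : x = ∑ i, b.repr ⟨x, hx⟩ i • (b i : B) := by
        have h := congrArg Subtype.val (b.sum_repr ⟨x, hx⟩)
        simpa only [AddSubmonoidClass.coe_finsetSum, Submodule.coe_smul_of_tower] using h.symm
      rw [hx']
      exact (localAt p A).sum_mem fun i _ => (localAt p A).smul_mem _ (hball i)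
  have h1 : (1 : B) ∈ J := le_localAt p L h1L
  set A : Submodule ℤ B := Submodule.span ℤ (↑(insert (1 : B) S') : Set B) with hAdef
  -- Step 4: `J⁴ ≤ J³`
  have hpow : ∀ k : ℕ, J ^ (k + 1) = localAt p (A ^ (k + 1)) := fun k => by
    rw [← hA, localAt_pow_succ]
  have hJ43 : J ^ 4 ≤ J ^ 3 := by
    have hA4 : A ^ 4 ≤ J ^ 3 := by
      rw [hAdef, Submodule.span_pow, Submodule.span_le]
      rintro x hx
      rw [show (4 : ℕ) = 1 + 1 + 1 + 1 from rfl, pow_succ, pow_succ, pow_succ, pow_one] at hx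
      obtain ⟨y, hy, d, hd, rfl⟩ := Set.mem_mul.mp hx
      obtain ⟨z, hz, c, hc, rfl⟩ := Set.mem_mul.mp hy
      obtain ⟨a, ha, b, hb, rfl⟩ := Set.mem_mul.mp hz
      exact prod_mem_pow_three_of_mem_insert hJp h1 hint hS'J hcard ha hb hc hd
    calc J ^ 4 = localAt p (A ^ 4) := hpow 3
      _ ≤ localAt p (J ^ 3) := localAt_mono p hA4
      _ = J ^ 3 := by rw [hpow 2, localAt_localAt]
  have hJ34 : J ^ 3 = J ^ 4 := by
    refine le_antisymm ?_ hJ43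
    calc J ^ 3 = J ^ 3 * 1 := (mul_one _).symm
      _ ≤ J ^ 3 * J := mul_le_mul' le_rfl (Submodule.one_le.mpr h1)
      _ = J ^ 4 := (pow_succ J 3).symm
  -- Step 5: peel off factors with the inverse
  obtain ⟨L', hLL', hL'L⟩ := hL.exists_inv
  set Lp' := localAt p L' with hLp'
  have hE1 : J * Lp' = leftOrderOf J := by
    rw [hJdef, hLp', localAt_mul_localAt_eq, hLL', leftOrderOf_localAt p hL.isFullLattice.1]
  have hE2 : leftOrderOf J ≤ rightOrderOf J :=
    leftOrderOf_le_rightOrderOf_of_semiOrder hL.isFullLattice.1 rfl h1 hint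
  have hE3 : J * leftOrderOf J = J := by
    refine le_antisymm (Submodule.mul_le.mpr fun x hx o ho => hE2 ho x hx) fun x hx => ?_
    rw [← mul_one x]
    exact Submodule.mul_mem_mul hx (one_mem_leftOrderOf J)
  have hE4 : ∀ k : ℕ, J ^ (k + 1) * leftOrderOf J = J ^ (k + 1) := fun k => by
    rw [pow_succ, mul_assoc, hE3]
  have hE5 : ∀ k : ℕ, J ^ (k + 2) * Lp' = J ^ (k + 1) := fun k => by
    rw [pow_succ, mul_assoc, hE1, hE4]
  have h43 : J ^ 4 * Lp' = J ^ 3 := hE5 2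
  have h32 : J ^ 3 * Lp' = J ^ 2 := hE5 1
  have h21 : J ^ 2 * Lp' = J ^ 1 := hE5 0
  have hJ23 : J ^ 2 = J ^ 3 :=
    calc J ^ 2 = J ^ 3 * Lp' := h32.symm
      _ = J ^ 4 * Lp' := by rw [hJ34]
      _ = J ^ 3 := h43
  have hJ12 : J ^ 1 = J ^ 2 :=
    calc J ^ 1 = J ^ 2 * Lp' := h21.symm
      _ = J ^ 3 * Lp' := by rw [hJ23]
      _ = J ^ 2 := h32
  have hJO : leftOrderOf J = J :=
    calc leftOrderOf J = J ^ 1 * Lp' := by rw [pow_one, hE1]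
      _ = J ^ 2 * Lp' := by rw [hJ12]
      _ = J ^ 1 := h21
      _ = J := pow_one J
  -- Step 6: `J = O_r(J) = O_(p)` and `I_(p) = α J`
  have hJright : J = localAt p O := by
    have hr : rightOrderOf J = localAt p O := by
      rw [hJdef, rightOrderOf_localAt p hL.isFullLattice.1, hL.rightOrderOf_eq]
    have hle : J ≤ rightOrderOf J := hJO.symm.le.trans hE2
    rw [hr] at hle
    refine le_antisymm hle fun o ho => ?_
    rw [← hr] at ho
    simpa using ho 1 h1
  have hIL : I = α • L := by rw [hLdef, smul_inv_smul]
  rw [hIL, localAt_units_smul, ← hJdef, hJright]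

end Kaplansky

/-! ### Transporters and the local criterion for invertibility -/

section Transporter

variable {B : Type u} [Ring B]

/-- The **right transporter** `(N : M)_r = {y ∈ B | M y ⊆ N}` of two lattices, as a `ℤ`-submodule
(Voight 15.6 / 16.5: for `N = O_ℓ(M)` this is the candidate inverse `{y | M y ⊆ O_ℓ(M)}` of `M`;
for `N = M` it is the right order `O_r(M)`, `transporterRight_self`). [folklore] -/
def transporterRight (M N : Submodule ℤ B) : Submodule ℤ B where
  carrier := {y | ∀ m ∈ M, m * y ∈ N}
  add_mem' {a b} ha hb m hm := by rw [mul_add]; exact N.add_mem (ha m hm) (hb m hm)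
  zero_mem' m _ := by rw [mul_zero]; exact N.zero_mem
  smul_mem' c {a} ha m hm := by rw [mul_smul_comm]; exact N.smul_mem c (ha m hm)

/-- The **left transporter** `(N : M)_ℓ = {x ∈ B | x M ⊆ N}` of two lattices (for `N = M` the left
order `O_ℓ(M)`; for right ideals `I, J` of an order, `(I : J)_ℓ = {b | b J ⊆ I}` is the lattice
`I J⁻¹` whose elements index the sub-ideals `b J ⊆ I`, Voight (26.5.7)). [folklore] -/
def transporterLeft (M N : Submodule ℤ B) : Submodule ℤ B where
  carrier := {x | ∀ m ∈ M, x * m ∈ N}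
  add_mem' {a b} ha hb m hm := by rw [add_mul]; exact N.add_mem (ha m hm) (hb m hm)
  zero_mem' m _ := by rw [zero_mul]; exact N.zero_mem
  smul_mem' c {a} ha m hm := by rw [smul_mul_assoc]; exact N.smul_mem c (ha m hm)

/-- `y ∈ (N : M)_r ↔ M y ⊆ N` (definitional). [folklore] -/
@[simp] theorem mem_transporterRight_iff {M N : Submodule ℤ B} {y : B} :
    y ∈ transporterRight M N ↔ ∀ m ∈ M, m * y ∈ N := Iff.rfl

/-- `x ∈ (N : M)_ℓ ↔ x M ⊆ N` (definitional). [folklore] -/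
@[simp] theorem mem_transporterLeft_iff {M N : Submodule ℤ B} {x : B} :
    x ∈ transporterLeft M N ↔ ∀ m ∈ M, x * m ∈ N := Iff.rfl

/-- `(M : M)_r = O_r(M)`. [folklore] -/
theorem transporterRight_self (M : Submodule ℤ B) : transporterRight M M = rightOrderOf M := rfl

/-- `(M : M)_ℓ = O_ℓ(M)`. [folklore] -/
theorem transporterLeft_self (M : Submodule ℤ B) : transporterLeft M M = leftOrderOf M := rfl

/-- `M · (N : M)_r ⊆ N`. [folklore] -/
theorem mul_transporterRight_le (M N : Submodule ℤ B) : M * transporterRight M N ≤ N :=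
  Submodule.mul_le.mpr fun m hm _ hy => hy m hm

/-- `(N : M)_ℓ · M ⊆ N`. [folklore] -/
theorem transporterLeft_mul_le (M N : Submodule ℤ B) : transporterLeft M N * M ≤ N :=
  Submodule.mul_le.mpr fun _ hx m hm => hx m hm

/-- `(N : M)_r,(p) ⊆ (N_(p) : M_(p))_r`. [folklore] -/
theorem localAt_transporterRight_le (p : ℕ) (M N : Submodule ℤ B) :
    localAt p (transporterRight M N) ≤ transporterRight (localAt p M) (localAt p N) := by
  rintro y ⟨m₀, hm0, hm, hmy⟩ m ⟨n, hn0, hn, hnm⟩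
  refine ⟨n * m₀, mul_ne_zero hn0 hm0, hn.mul_left hm, ?_⟩
  rw [Nat.cast_mul, mul_smul, ← mul_smul_comm, ← smul_mul_assoc]
  exact hmy _ hnm

/-- **Right transporters localise**: `(N_(p) : M_(p))_r = (N : M)_r,(p)` for `M` finitely
generated. [folklore] -/
theorem transporterRight_localAt (p : ℕ) {M : Submodule ℤ B} (hM : M.FG) (N : Submodule ℤ B) :
    transporterRight (localAt p M) (localAt p N) = localAt p (transporterRight M N) := by
  classical
  refine le_antisymm (fun y hy => ?_) (localAt_transporterRight_le p M N)
  obtain ⟨t, rfl⟩ := hM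
  have key : ∀ g ∈ t, ∃ m : ℕ, m ≠ 0 ∧ m.Coprime p ∧ (m : ℤ) • (g * y) ∈ N :=
    fun g hg => hy g (le_localAt p _ (Submodule.subset_span hg))
  choose! m hm0 hm hmy using key
  refine ⟨∏ g ∈ t, m g, Finset.prod_ne_zero_iff.mpr fun g hg => hm0 g hg,
    Nat.Coprime.prod_left fun g hg => hm g hg, fun x hx => ?_⟩
  rw [mul_smul_comm]
  refine Submodule.span_induction (p := fun x _ => ((∏ g ∈ t, m g : ℕ) : ℤ) • (x * y) ∈ N)
    (fun g hg => ?_) (by simp) (fun a b _ _ ha hb => ?_) (fun c a _ ha => ?_) hx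
  · rw [← Finset.prod_erase_mul _ _ hg, Nat.cast_mul, mul_smul]
    exact N.smul_mem _ (hmy g hg)
  · rw [add_mul, smul_add]
    exact add_mem ha hb
  · rw [smul_mul_assoc, smul_comm]
    exact N.smul_mem _ ha

/-- `(N_(p) : M_(p))_ℓ ⊇ (N : M)_ℓ,(p)`. [folklore] -/
theorem localAt_transporterLeft_le (p : ℕ) (M N : Submodule ℤ B) :
    localAt p (transporterLeft M N) ≤ transporterLeft (localAt p M) (localAt p N) := by
  rintro x ⟨m₀, hm0, hm, hmx⟩ m ⟨n, hn0, hn, hnm⟩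
  refine ⟨m₀ * n, mul_ne_zero hm0 hn0, hm.mul_left hn, ?_⟩
  rw [Nat.cast_mul, mul_smul, smul_comm, ← smul_mul_assoc, ← mul_smul_comm]
  exact hmx _ hnm

/-- **Left transporters localise**: `(N_(p) : M_(p))_ℓ = (N : M)_ℓ,(p)` for `M` finitely
generated. [folklore] -/
theorem transporterLeft_localAt (p : ℕ) {M : Submodule ℤ B} (hM : M.FG) (N : Submodule ℤ B) :
    transporterLeft (localAt p M) (localAt p N) = localAt p (transporterLeft M N) := by
  classical
  refine le_antisymm (fun x hx => ?_) (localAt_transporterLeft_le p M N)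
  obtain ⟨t, rfl⟩ := hM
  have key : ∀ g ∈ t, ∃ m : ℕ, m ≠ 0 ∧ m.Coprime p ∧ (m : ℤ) • (x * g) ∈ N :=
    fun g hg => hx g (le_localAt p _ (Submodule.subset_span hg))
  choose! m hm0 hm hmx using key
  refine ⟨∏ g ∈ t, m g, Finset.prod_ne_zero_iff.mpr fun g hg => hm0 g hg,
    Nat.Coprime.prod_left fun g hg => hm g hg, fun y hy => ?_⟩
  rw [smul_mul_assoc]
  refine Submodule.span_induction (p := fun y _ => ((∏ g ∈ t, m g : ℕ) : ℤ) • (x * y) ∈ N)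
    (fun g hg => ?_) (by simp) (fun a b _ _ ha hb => ?_) (fun c a _ ha => ?_) hy
  · rw [← Finset.prod_erase_mul _ _ hg, Nat.cast_mul, mul_smul]
    exact N.smul_mem _ (hmx g hg)
  · rw [mul_add, smul_add]
    exact add_mem ha hb
  · rw [mul_smul_comm, smul_comm]
    exact N.smul_mem _ ha

/-- The right transporter of a principal lattice into its left order: for a multiplicatively
closed `Λ ∋ 1` with `O_ℓ(Λ) = Λ` and a unit `β`, `(O_ℓ(β Λ) : β Λ)_r = Λ β⁻¹`. [folklore] -/
theorem transporterRight_units_smul_leftOrderOf {Λ : Submodule ℤ B} (h1 : (1 : B) ∈ Λ)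
    (hmul : ∀ a ∈ Λ, ∀ b ∈ Λ, a * b ∈ Λ) (hΛ : leftOrderOf Λ = Λ) (β : Bˣ) :
    transporterRight (β • Λ) (leftOrderOf (β • Λ)) = MulOpposite.op ((β⁻¹ : Bˣ) : B) • Λ := by
  rw [leftOrderOf_units_smul, hΛ]
  ext y
  rw [mem_transporterRight_iff, mem_op_units_smul_submodule_iff, inv_inv]
  constructor
  · intro h
    have hβ : (β : B) ∈ β • Λ := by
      have h' := Submodule.smul_mem_pointwise_smul (1 : B) β Λ h1
      rwa [Units.smul_def, smul_eq_mul, mul_one] at h'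
    have := h (β : B) hβ
    rw [mem_units_smul_submodule_iff, Units.smul_def, smul_eq_mul, Units.inv_mul_cancel_left,
      mem_op_units_smul_submodule_iff, inv_inv] at this
    exact this
  · intro hy m hm
    obtain ⟨a, ha, rfl⟩ := (Submodule.mem_smul_pointwise_iff_exists m β Λ).mp hm
    rw [mem_units_smul_submodule_iff, Units.smul_def, Units.smul_def, smul_eq_mul, smul_eq_mul,
      mul_assoc, Units.inv_mul_cancel_left, mem_op_units_smul_submodule_iff, inv_inv, mul_assoc]
    exact hmul a ha _ hy

end Transporter

section LocalCriterion

variable {B : Type u} [Ring B] [Algebra ℚ B] [IsQuaternionAlgebra ℚ B]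

omit [Algebra ℚ B] [IsQuaternionAlgebra ℚ B] in
/-- The localisation of a `ℤ`-order is its own left order: `O_ℓ(O_(p)) = O_(p)`. [folklore] -/
theorem IsZOrder.leftOrderOf_localAt_eq {O : Submodule ℤ B} (hO : IsZOrder O) (p : ℕ) :
    leftOrderOf (localAt p O) = localAt p O := by
  rw [leftOrderOf_localAt p hO.isFullLattice.1]
  exact congrArg (localAt p) (Brandt.IsOrder.leftOrder_eq ⟨hO.one_mem, hO.mul_mem, hO.isFullLattice⟩)

omit [Algebra ℚ B] [IsQuaternionAlgebra ℚ B] in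
/-- The localisation of a `ℤ`-order is its own right order: `O_r(O_(p)) = O_(p)`. [folklore] -/
theorem IsZOrder.rightOrderOf_localAt_eq {O : Submodule ℤ B} (hO : IsZOrder O) (p : ℕ) :
    rightOrderOf (localAt p O) = localAt p O := by
  rw [rightOrderOf_localAt p hO.isFullLattice.1]
  exact congrArg (localAt p) (Brandt.IsOrder.rightOrder_eq ⟨hO.one_mem, hO.mul_mem, hO.isFullLattice⟩)

omit [Algebra ℚ B] [IsQuaternionAlgebra ℚ B] in
/-- `M * (N c) = (M N) c`: right translation of the right factor. [folklore] -/
theorem mul_op_smul_eq_op_smul_mul (c : B) (M N : Submodule ℤ B) :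
    M * (MulOpposite.op c • N) = MulOpposite.op c • (M * N) := by
  apply le_antisymm
  · rw [Submodule.mul_le]
    intro m hm x hx
    obtain ⟨n, hn, rfl⟩ := (Submodule.mem_smul_pointwise_iff_exists x _ N).mp hx
    rw [MulOpposite.smul_eq_mul_unop, MulOpposite.unop_op, ← mul_assoc]
    exact Submodule.smul_mem_pointwise_smul _ _ _ (Submodule.mul_mem_mul hm hn)
  · intro x hx
    obtain ⟨y, hy, rfl⟩ := (Submodule.mem_smul_pointwise_iff_exists x _ (M * N)).mp hx
    rw [MulOpposite.smul_eq_mul_unop, MulOpposite.unop_op]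
    refine Submodule.mul_induction_on hy (fun m hm n hn => ?_) (fun a b ha hb => ?_)
    · rw [mul_assoc]
      exact Submodule.mul_mem_mul hm (Submodule.smul_mem_pointwise_smul n _ N hn)
    · rw [add_mul]
      exact add_mem ha hb

omit [IsQuaternionAlgebra ℚ B] in
/-- **The local criterion for invertibility** (Voight, Main Thm. 16.6.1, direction "locally
principal ⇒ invertible", 16.6.14): a full lattice `M` which is locally principal over the
`ℤ`-order `O` at every prime — `M_(q) = β_q O_(q)` — is an invertible right `O`-ideal; its
inverse is the right transporter `{y | M y ⊆ O_ℓ(M)}`, locally `O_(q) β_q⁻¹`, and the identities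
`M M' = O_ℓ(M)`, `M' M = O`, `O_r(M) = O` are checked prime by prime. [cite: Voight2021, Main Thm. 16.6.1] -/
theorem IsInvertibleRightIdeal.of_forall_localAt_eq_units_smul {O M : Submodule ℤ B}
    (hO : IsZOrder O) (hM : IsFullLattice B M)
    (hloc : ∀ q : ℕ, q.Prime → ∃ β : Bˣ, localAt q M = β • localAt q O) :
    IsInvertibleRightIdeal O M := by
  have hOq : ∀ q : ℕ, localAt q O * localAt q O = localAt q O := hO.localAt_mul_localAt
  refine ⟨hM, ?_, transporterRight M (leftOrderOf M), ?_, ?_⟩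
  · -- `O_r(M) = O`
    refine eq_iff_forall_prime_localAt_eq.mpr fun q hq => ?_
    obtain ⟨β, hβ⟩ := hloc q hq
    rw [← rightOrderOf_localAt q hM.1, hβ, rightOrderOf_units_smul, hO.rightOrderOf_localAt_eq]
  · -- `M M' = O_ℓ(M)`
    refine eq_iff_forall_prime_localAt_eq.mpr fun q hq => ?_
    obtain ⟨β, hβ⟩ := hloc q hq
    rw [← localAt_mul_localAt_eq, ← transporterRight_localAt q hM.1, ← leftOrderOf_localAt q hM.1,
      hβ, transporterRight_units_smul_leftOrderOf (le_localAt q O hO.one_mem)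
        (fun a ha b hb => mul_mem_localAt hO.mul_mem q ha hb) (hO.leftOrderOf_localAt_eq q),
      leftOrderOf_units_smul, hO.leftOrderOf_localAt_eq, smul_mul_assoc, mul_op_smul_eq_op_smul_mul,
      hOq]
  · -- `M' M = O`
    refine eq_iff_forall_prime_localAt_eq.mpr fun q hq => ?_
    obtain ⟨β, hβ⟩ := hloc q hq
    rw [← localAt_mul_localAt_eq, ← transporterRight_localAt q hM.1, ← leftOrderOf_localAt q hM.1,
      hβ, transporterRight_units_smul_leftOrderOf (le_localAt q O hO.one_mem)
        (fun a ha b hb => mul_mem_localAt hO.mul_mem q ha hb) (hO.leftOrderOf_localAt_eq q),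
      op_smul_mul_eq_mul_smul, ← units_smul_submodule_eq, inv_smul_smul, hOq]

/-- **Invertible ⇔ locally principal** (Voight Main Thm. 16.6.1 over `ℤ`, both directions): for a
full lattice `M` in a division quaternion algebra over `ℚ` and a `ℤ`-order `O`, `M` is an
invertible right `O`-ideal iff `M_(q) = β_q O_(q)` for every prime `q`. [cite: Voight2021, Main Thm. 16.6.1] -/
theorem isInvertibleRightIdeal_iff_forall_localAt_eq (hdiv : ∀ x : B, x ≠ 0 → IsUnit x)
    {O M : Submodule ℤ B} (hO : IsZOrder O) (hM : IsFullLattice B M) :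
    IsInvertibleRightIdeal O M ↔ ∀ q : ℕ, q.Prime → ∃ β : Bˣ, localAt q M = β • localAt q O :=
  ⟨fun h q hq => by
    haveI : Fact q.Prime := ⟨hq⟩
    obtain ⟨β, -, hβ⟩ := h.exists_localAt_eq_units_smul hdiv hO q
    exact ⟨β, hβ⟩,
  IsInvertibleRightIdeal.of_forall_localAt_eq_units_smul hO hM⟩

end LocalCriterion

end Literature.NumberTheory.Automorphic
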